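import Literature.Geometry.Lorentzian.KerrCarterModeInterface
import Literature.Geometry.Lorentzian.KerrTimeDominatedEstimate
import HarnessLib

/-!
# The `𝓖_♯` multiplier estimate applied to the Carter modes of a cut-off solution

Dafermos–Rodnianski–Shlapentokh-Rothman, arXiv:1402.7034, §13.1.2: "We apply now Theorem
(phaseSpaceILED). In view of the support of `ũ`, it follows that the term `|ũ(-∞)|²` vanishes …".
This file performs that step for one frequency range, the time-dominated range `𝓖_♯`
(Prop. 8.4.1, the tree's `Kerr.timeDominated_estimate_kerr`), through the Carter-mode interface
(`Kerr.carter_mode_interface`): for a.e. `ξ` and every mode `q` with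
`(ω, m, Λ) = (-2πξ, q.1, λ_q(aω) + a²ω²) ∈ 𝓖_♯(ω_high, ε_width)`, the mode functions `U, U₁, H` of
the cut-off solution satisfy
`(3Mδ²/16R_d⁴) ∫_{x₁}^{x₂} (|U₁|² + (ω² + Λ)|U|²) ≤ ∫ (-2y Re(U₁H̄) + Eω Im(HŪ))`
with **no boundary terms** (`Kerr.carter_mode_timeDominated`). The other ranges of Theorem 8.1 are
applied in exactly the same way.

## References

* M. Dafermos, I. Rodnianski, Y. Shlapentokh-Rothman, arXiv:1402.7034, Prop. 8.4.1, §13.1.2.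
  [DafermosRodnianskiShlapentokhrothman2014]
-/

noncomputable section

open Real Set Filter MeasureTheory Function
open scoped Topology ENNReal InnerProductSpace ComplexConjugate FourierTransform

namespace Literature.Geometry.Lorentzian

namespace Kerr

open Literature.Analysis.SpecialFunctions Literature.Analysis.FunctionSpaces
  Literature.Analysis.Fourier Literature.Analysis.Calculus

variable [h2π : Fact (0 < 2 * π)]

/-- **Prop. 8.4.1 on the Carter modes of a cut-off solution, for a.e. frequency.** Hypotheses: the
Carter-mode interface data (`carter_mode_interface`) and the parameters of
`timeDominated_estimate_kerr` (`R_d ≥ 8M`, `ε_width ≤ 1`, `10³ε_width R_d² ≤ M⁴`,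
`10⁴R_d² ≤ M⁴ω²_high`, `E ≥ 2`, an `r*`-interval `[x₁, x₂]` with `R x₁ ≥ r₊ + δ`, `R x₂ ≤ R_d - M`).
Conclusion: for a.e. `ξ`, for every mode `q` in the range `𝓖_♯` (`ω_high ≤ |ω|`, `Λ ≤ ε_width ω²`,
`ω(ω - ω₊m) ≥ 0`; `ω = -2πξ`, `m = q.1`, `Λ = λ_q(aω) + a²ω²`), the estimate of Prop. 8.4.1 holds
for the mode functions `U = nfU …`, `U₁ = nfU₁ …`, `H = modeH …` with vanishing boundary terms.
[cite: DafermosRodnianskiShlapentokhrothman2014, Prop. 8.4.1, §13.1.2] -/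
theorem carter_mode_timeDominated (a M : ℝ) (hMa : IsSubextremal M a) {R : ℝ → ℝ}
    (hR : IsTortoiseRadius M a R) {Φ : E4 → ℝ} (hΦ : ContDiff ℝ 4 Φ) {W : E4 → ℝ}
    (hW2 : ContDiff ℝ 2 W) (hW : ∀ q : E4, 0 < q 1 → sin (q 2) ≠ 0 → W q = sepRHS a M Φ q)
    (hIW : ∀ r, TimeSqInt W hW2.continuous r)
    (hIW1 : ∀ r, TimeSqInt (dir 1 W) (contDiff_one_dir hW2 1).continuous r)
    {cW : ℝ} (hcW : 0 ≤ cW)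
    (hBW : ∀ r, ∫⁻ t, ‖angSlice (dir 1 (dir 1 W))
      (continuous_dir (contDiff_one_dir hW2 1) one_ne_zero 1) t r‖ₑ ^ 2 ≤ ENNReal.ofReal (cW ^ 2))
    (hIF : ∀ r, TimeSqInt (starPull a Φ)
      (contDiff_two_starPull a (contDiff_two_of_four hΦ)).continuous r)
    (hI0 : ∀ r, TimeSqInt (dir 0 (starPull a Φ))
      (continuous_dir (contDiff_one_starPull a (contDiff_two_of_four hΦ)) one_ne_zero 0) r)
    (hJ1 : ∀ r, TimeSqInt (dir 1 (starPull a Φ)) (contDiff_two_D1 a hΦ).continuous r)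
    (hJ2 : ∀ r, TimeSqInt (dir 1 (dir 1 (starPull a Φ))) (contDiff_two_D2 a hΦ).continuous r)
    (hJ3 : ∀ r, TimeSqInt (dir 1 (dir 1 (dir 1 (starPull a Φ))))
      (contDiff_one_D3 a hΦ).continuous r)
    (hIA : ∀ i r, TimeSqInt (sepAtom a Φ i) (continuous_sepAtom a (contDiff_two_of_four hΦ) i) r)
    {c : ℝ} (hc : 0 ≤ c)
    (hB2 : ∀ r, ∫⁻ t, ‖angSlice (dir 1 (dir 1 (starPull a Φ))) (contDiff_two_D2 a hΦ).continuous
      t r‖ₑ ^ 2 ≤ ENNReal.ofReal (c ^ 2))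
    (hB3 : ∀ r, ∫⁻ t, ‖angSlice (dir 1 (dir 1 (dir 1 (starPull a Φ))))
      (contDiff_one_D3 a hΦ).continuous t r‖ₑ ^ 2 ≤ ENNReal.ofReal (c ^ 2))
    (hB4 : ∀ r, ∫⁻ t, ‖angSlice (dir 1 (dir 1 (dir 1 (dir 1 (starPull a Φ)))))
      (continuous_D4 a hΦ) t r‖ₑ ^ 2 ≤ ENNReal.ofReal (c ^ 2))
    {r_a r_b : ℝ} (hra : rPlus M a < r_a) (hab : r_a ≤ r_b)
    {r_a' r_b' : ℝ} (hra' : r_a < r_a') (hab' : r_a' ≤ r_b') (hrb' : r_b' < r_b)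
    (hzF : ∀ q : E4, q 1 ∈ Ioo r_a r_b → q 1 ∉ Icc r_a' r_b' → starPull a Φ q = 0)
    (hzW : ∀ q : E4, q 1 ∈ Ioo r_a r_b → q 1 ∉ Icc r_a' r_b' → W q = 0)
    -- parameters of Prop. 8.4.1
    {Rd ε ωh E δ x₁ x₂ : ℝ} (hRd : 8 * M ≤ Rd) (hωh0 : 0 ≤ ωh) (hε₁ : ε ≤ 1)
    (hε : 10 ^ 3 * ε * Rd ^ 2 ≤ M ^ 4) (hωh' : 10 ^ 4 * Rd ^ 2 ≤ M ^ 4 * ωh ^ 2) (hE : 2 ≤ E)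
    (hδ : 0 < δ) (hx : x₁ ≤ x₂) (hx₁ : rPlus M a + δ ≤ R x₁) (hx₂ : R x₂ ≤ Rd - M) :
    ∃ u u₁ w : ℝ → ℝ → AngSpace,
      (∀ r ∈ Icc r_a r_b, u r =ᵐ[volume]
        (freqLp (starPull a Φ) (contDiff_two_starPull a (contDiff_two_of_four hΦ)).continuous
          hIF r : ℝ → AngSpace)) ∧
      (∀ r ∈ Icc r_a r_b, w r =ᵐ[volume] (freqLp W hW2.continuous hIW r : ℝ → AngSpace)) ∧
      ∀ᵐ ξ ∂volume, ∀ q : OblateSphereIndex (a * (-2 * π * ξ)),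
        ωh ≤ |(-2 * π * ξ)| →
        oblateSphereEig (a * (-2 * π * ξ)) q + a ^ 2 * (-2 * π * ξ) ^ 2 ≤ ε * (-2 * π * ξ) ^ 2 →
        0 ≤ (-2 * π * ξ) * ((-2 * π * ξ) - horizonAngularVelocity M a * q.1) →
        3 * M * δ ^ 2 / (16 * Rd ^ 4) * ∫ x in x₁..x₂,
            (‖nfU₁ M a (-2 * π * ξ) q.1 R (nfPhase M a (-2 * π * ξ) q.1)
                (modeCoef (oblateSphereBasis (2 * π) (a * (-2 * π * ξ)) q) u ξ r_a r_b)
                (modeCoef (oblateSphereBasis (2 * π) (a * (-2 * π * ξ)) q) u₁ ξ r_a r_b) x‖ ^ 2 +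
              ((-2 * π * ξ) ^ 2 +
                  (oblateSphereEig (a * (-2 * π * ξ)) q + a ^ 2 * (-2 * π * ξ) ^ 2)) *
                ‖nfU a R (nfPhase M a (-2 * π * ξ) q.1)
                  (modeCoef (oblateSphereBasis (2 * π) (a * (-2 * π * ξ)) q) u ξ r_a r_b) x‖ ^ 2) ≤
          ∫ x, (-(2 * tdWeight M a Rd (R x) *
              ⟪modeH M a R (nfPhase M a (-2 * π * ξ) q.1)
                  (modeCoef (oblateSphereBasis (2 * π) (a * (-2 * π * ξ)) q) w ξ r_a r_b) x,
                nfU₁ M a (-2 * π * ξ) q.1 R (nfPhase M a (-2 * π * ξ) q.1)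
                  (modeCoef (oblateSphereBasis (2 * π) (a * (-2 * π * ξ)) q) u ξ r_a r_b)
                  (modeCoef (oblateSphereBasis (2 * π) (a * (-2 * π * ξ)) q) u₁ ξ r_a r_b) x⟫_ℝ) +
            E * ((-2 * π * ξ) *
              (modeH M a R (nfPhase M a (-2 * π * ξ) q.1)
                  (modeCoef (oblateSphereBasis (2 * π) (a * (-2 * π * ξ)) q) w ξ r_a r_b) x *
                conj (nfU a R (nfPhase M a (-2 * π * ξ) q.1)
                  (modeCoef (oblateSphereBasis (2 * π) (a * (-2 * π * ξ)) q) u ξ r_a r_b)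
                  x)).im)) := by
  obtain ⟨u, u₁, u₂, w, hru, hrw, hae⟩ := carter_mode_interface a M hMa hR hΦ hW2 hW hIW hIW1 hcW
    hBW hIF hI0 hJ1 hJ2 hJ3 hIA hc hB2 hB3 hB4 hra hab hra' hab' hrb' hzF hzW
  refine ⟨u, u₁, w, hru, hrw, ?_⟩
  filter_upwards [hae] with ξ hξ
  intro q hωh hΛ hns
  obtain ⟨-, -, -, -, hq⟩ := hξ
  obtain ⟨U, U₁, U₂, H, x_a, x_b, hU, hU₁, hH, hUd, hU₁d, hode, hUc, hU₁c, hHc, hsupp, hadm⟩ := hq q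
  obtain ⟨hb_top, hb_bot, hA_top, hA_bot, hS₁, hS₂⟩ := mode_bc_of_support hUc hU₁c hHc hsupp
    (Complex.I * ((-2 * π * ξ : ℝ) : ℂ))
    (Complex.I * (((-2 * π * ξ) - horizonAngularVelocity M a * q.1 : ℝ) : ℂ))
  have h := timeDominated_estimate_kerr (u := U) (u₁ := U₁) (u₂ := U₂) (H := H) hMa hR hRd hadm hωh0
    hωh hΛ hns hε₁ hε hωh' hE hUd hU₁d hode hHc hS₁ hS₂
    (by simpa [mul_assoc] using hb_top) (by simpa [mul_assoc] using hb_bot) hA_top hA_bot hδ hx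
    hx₁ hx₂
  rw [hU, hU₁, hH] at h
  exact h

end Kerr

end Literature.Geometry.Lorentzian
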